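import Summits.QuantumFields.BalabanUV.T4Continuum.Support.RegionCollarLift

/-!
# `BalabanUV.T4Continuum.Support.RegionBoxCollarFold` — NE2 (node U1a) formalisation swarm, SUPPLIER item «Δ1-VEC-W1-HOLED» v3 under the
# owner's sub-row `T4-U1a.S-NE2-D1-DIRICHLET°` (vector layer W1): THE COLLAR OF A BOX OF BLOCKS `K = Π_ν [lo_ν, lo_ν + len_ν)` IN THE DIGIT
# CHART AND THE COORDINATEWISE FOLD `F : collar(K) → K` «not in print; our construction» (unit b2b-balaban-t4-ne2-formalise-leaf-09, gen 9, v1)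

HONEST FRAMING (T4-DAG p. 1).  [folklore] lattice bookkeeping only: the generalisation of `RegionCollarFold` (one block, `len = 1`) to a
box of blocks.  Collar blocks `(cblk k)_ν = lo_ν − 1 + k_ν`, `k_ν ∈ {0, …, len_ν + 1}` (distinct when `len_ν + 2 ≤ M_ν`); offsets
`koff x ν = ((blockOf x)_ν − (lo_ν − 1)).val`; INSIDE directions `1 ≤ k_ν ≤ len_ν`; (the offset chart `koff` of `RegionCollarFold` with the corner `lo` in place of `w`); the CLAMP `0 ↦ 1`, `len+1 ↦ len`, identity inside; the
FOLD `F x = bpt (clamped block) (j_ν inside, rev j_ν outside)` — `F = id` on `K`; along a bond the two images are the same bond of `K`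
(inside direction, including the crossing between two adjacent blocks of `K`), the reversed bond (outside direction), or coincide (the two
reflection interfaces).  Nothing printed is a hypothesis; NE2 (U1a) NOT proved; spine PROVED 0/9 unchanged; NOT [B9] (3.23)–(3.27) as
printed; NOT infinite volume, NOT the mass gap, NOT Clay.  HONEST DEPENDENCY (verbatim): «continuum YM on T⁴ ⇐ BetaPertH ∧ nine spine
estimates (0/9 proved); BetaPertH ⇐ (D1) ∧ (D4) ∧ CAP+tail; G-an2-4 gates asym, D1 and NE2/3/4.»

ABSOLUTE RULE (cell, verbatim): «No internally-minted statement may enter as a cited fact. Every hypothesis is either kernel-proved in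
this package or a verbatim quotation of a PUBLISHED theorem with page reference. The manuscript(s) under audit are NOT citable for
their own disputed steps — they are the thing under adjudication; programme-internal (2001/route/tribunal) claims are never citable.»
[folklore] throughout; data defs only (`cblkB`, `csiteB`, `KOff`∕`collarB` (`Finset`s), `clampN`, `clampK`, `foldDB`, `foldB`); no
`def … : Prop`.  NOT CLAIMED: anything analytic; NE2; NE3.
-/

noncomputable section

open scoped BigOperators ComplexConjugate Matrix
open Finset

namespace Summit.QuantumFields.BalabanUV.T4Continuum.RegionBoxCollarFold

open Literature.MathematicalPhysics.QuantumFieldTheory.Balaban1983to89.B5Prop11Plancherel (Tor fine unitVec)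
open Literature.MathematicalPhysics.QuantumFieldTheory.Balaban1983to89.B5Block118 (bpt)
open Literature.MathematicalPhysics.QuantumFieldTheory.Balaban1983to89.B5Blocks16 (blockOf blockOf_bpt bpt_injective)
open Summit.QuantumFields.BalabanUV.T4Continuum
open Summit.QuantumFields.BalabanUV.T4Continuum.ScalarBlockTrialFunction (digits digits_bpt bpt_add_unitVec_of_lt bpt_add_unitVec_of_eq)
open Summit.QuantumFields.BalabanUV.T4Continuum.RegionGaugeFixedVectorFlat (bpt_blockOf_digits blockOf_add_unitVec)
open Summit.QuantumFields.BalabanUV.T4Continuum.RegionCollarFold (koff digits_add_unitVec_of_eq digits_add_unitVec_of_lt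
  koff_add_unitVec_of_ne koff_add_unitVec_of_lt koff_add_unitVec_of_eq)

variable {d : ℕ} (n : ℕ) [NeZero n] (M : Fin d → ℕ) [hM : ∀ μ, NeZero (M μ)] (lo : Tor M) (len : Fin d → ℕ)

/-! ## §1 The collar chart of a box (offsets as plain naturals) -/

/-- the collar block with offsets `k : Fin d → ℕ` (meaningful for `k_ν ≤ len_ν + 1`): `(cblk k)_ν = lo_ν − 1 + k_ν`. [folklore] -/
def cblkB (k : Fin d → ℕ) : Tor M := fun ν => lo ν - 1 + ((k ν : ℕ) : ZMod (M ν))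

/-- collar site. [folklore] -/
def csiteB (k : Fin d → ℕ) (j : Fin d → Fin n) : Tor (fine n M) := bpt n M (cblkB M lo k) j

/-- the offset index set of the collar: `k_ν < len_ν + 2`. [folklore] -/
def KOff : Finset (Fin d → ℕ) := Fintype.piFinset fun ν => range (len ν + 2)

omit hM in
/-- membership in the offset index set. [folklore] -/
@[simp] theorem mem_KOff {k : Fin d → ℕ} : k ∈ KOff len ↔ ∀ ν, k ν < len ν + 2 := by
  simp [KOff, Fintype.mem_piFinset]

/-- the collar of the box as a finite set of sites. [folklore] -/
def collarB : Finset (Tor (fine n M)) := univ.filter fun x => ∀ ν, koff n M lo x ν < len ν + 2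

/-- membership. [folklore] -/
@[simp] theorem mem_collarB {x : Tor (fine n M)} : x ∈ collarB n M lo len ↔ ∀ ν, koff n M lo x ν < len ν + 2 := by
  simp [collarB]

/-- offsets of a collar site (`k_ν < M_ν`). [folklore] -/
theorem koffB_csiteB (k : Fin d → ℕ) (hk : ∀ ν, k ν < M ν) (j : Fin d → Fin n) : koff n M lo (csiteB n M lo k j) = k := by
  funext ν
  rw [koff, csiteB, blockOf_bpt]
  simp only [cblkB]
  rw [add_sub_cancel_left, ZMod.val_natCast, Nat.mod_eq_of_lt (hk ν)]

/-- digits of a collar site. [folklore] -/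
theorem digits_csiteB (k : Fin d → ℕ) (j : Fin d → Fin n) : digits n M (csiteB n M lo k j) = j := digits_bpt n M _ j

/-- **THE CHART INVERTS ITSELF EVERYWHERE**: `csite (koff x) (digits x) = x` for every site. [folklore] -/
theorem csiteB_koff (x : Tor (fine n M)) : csiteB n M lo (koff n M lo x) (digits n M x) = x := by
  rw [csiteB]
  conv_rhs => rw [← bpt_blockOf_digits n M x]
  congr 1
  funext ν
  simp only [cblkB, koff]
  rw [ZMod.natCast_zmod_val, add_sub_cancel]

/-- the block of any site in the chart. [folklore] -/
theorem blockOf_eq_cblkB (x : Tor (fine n M)) : blockOf n M x = cblkB M lo (koff n M lo x) := by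
  conv_lhs => rw [← csiteB_koff n M lo x]
  rw [csiteB, blockOf_bpt]

/-- collar sites have offsets in the index set (`len_ν + 2 ≤ M_ν`). [folklore] -/
theorem koffB_mem_KOff {x : Tor (fine n M)} (hx : x ∈ collarB n M lo len) : koff n M lo x ∈ KOff len :=
  (mem_KOff len).2 ((mem_collarB n M lo len).1 hx)

/-- the chart is injective on the index set (`len_ν + 2 ≤ M_ν`). [folklore] -/
theorem csiteB_injOn (hM2 : ∀ μ, len μ + 2 ≤ M μ) :
    Set.InjOn (fun kj : (Fin d → ℕ) × (Fin d → Fin n) => csiteB n M lo kj.1 kj.2) ↑(KOff len ×ˢ (univ : Finset (Fin d → Fin n))) := by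
  rintro ⟨k, j⟩ hk ⟨k', j'⟩ hk' h
  simp only [Finset.coe_product, Set.mem_prod, Finset.mem_coe, mem_KOff] at hk hk'
  simp only at h
  have hkM : ∀ ν, k ν < M ν := fun ν => lt_of_lt_of_le (hk.1 ν) (hM2 ν)
  have hkM' : ∀ ν, k' ν < M ν := fun ν => lt_of_lt_of_le (hk'.1 ν) (hM2 ν)
  have hk1 : k = k' := by
    have h1 := koffB_csiteB n M lo k hkM j
    have h2 := koffB_csiteB n M lo k' hkM' j'
    rw [h] at h1; rw [h1] at h2; exact h2
  have hj : j = j' := by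
    have h1 := digits_csiteB n M lo k j
    have h2 := digits_csiteB n M lo k' j'
    rw [h] at h1; rw [h1] at h2; exact h2
  rw [hk1, hj]

/-! ## §2 Clamp and fold -/

/-- the clamp of an offset into the inside range `{1, …, l}`: `0 ↦ 1`, `t ↦ t` for `1 ≤ t ≤ l`, `t ↦ l` above. [folklore] -/
def clampN (l t : ℕ) : ℕ := if t = 0 then 1 else if t ≤ l then t else l

omit [NeZero n] hM in
/-- the clamp lands in `{1, …, l}` (`1 ≤ l`). [folklore] -/
theorem clampN_mem {l : ℕ} (hl : 1 ≤ l) (t : ℕ) : 1 ≤ clampN l t ∧ clampN l t ≤ l := by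
  unfold clampN; split_ifs <;> omega

omit [NeZero n] hM in
/-- the clamp is the identity inside. [folklore] -/
theorem clampN_of_inside {l t : ℕ} (h1 : 1 ≤ t) (h2 : t ≤ l) : clampN l t = t := by
  unfold clampN; rw [if_neg (by omega), if_pos h2]

/-- clamped offsets. [folklore] -/
def clampK (k : Fin d → ℕ) : Fin d → ℕ := fun ν => clampN (len ν) (k ν)

/-- folded digits: identity in the inside directions, reversal outside. [folklore] -/
def foldDB (k : Fin d → ℕ) (j : Fin d → Fin n) : Fin d → Fin n :=
  fun μ => if 1 ≤ k μ ∧ k μ ≤ len μ then j μ else Fin.rev (j μ)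

/-- **THE FOLD** of the box collar into the box: `F x = csite (clamp (koff x)) (foldD (koff x) (digits x))`. [folklore] -/
def foldB (x : Tor (fine n M)) : Tor (fine n M) :=
  csiteB n M lo (clampK len (koff n M lo x)) (foldDB n len (koff n M lo x) (digits n M x))

/-- the fold of a collar site in the chart (`k_ν < M_ν`). [folklore] -/
theorem foldB_csiteB (k : Fin d → ℕ) (hk : ∀ ν, k ν < M ν) (j : Fin d → Fin n) :
    foldB n M lo len (csiteB n M lo k j) = csiteB n M lo (clampK len k) (foldDB n len k j) := by
  rw [foldB, koffB_csiteB n M lo k hk, digits_csiteB]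

/-- **`F = id` ON THE BOX**: if every offset of `x` is inside, `F x = x`. [folklore] -/
theorem foldB_of_inside {x : Tor (fine n M)} (hx : ∀ ν, 1 ≤ koff n M lo x ν ∧ koff n M lo x ν ≤ len ν) : foldB n M lo len x = x := by
  have hd : foldDB n len (koff n M lo x) (digits n M x) = digits n M x := funext fun μ => if_pos (hx μ)
  have hb : clampK len (koff n M lo x) = koff n M lo x := funext fun ν => clampN_of_inside (hx ν).1 (hx ν).2
  rw [foldB, hd, hb, csiteB_koff]

/-- the offsets of the fold are the clamped offsets (`len_ν + 2 ≤ M_ν`, `1 ≤ len_ν`). [folklore] -/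
theorem koffB_foldB (hlen : ∀ ν, 1 ≤ len ν) (hM2 : ∀ μ, len μ + 2 ≤ M μ) (x : Tor (fine n M)) :
    koff n M lo (foldB n M lo len x) = clampK len (koff n M lo x) := by
  rw [foldB, koffB_csiteB]
  intro ν
  have := (clampN_mem (hlen ν) (koff n M lo x ν)).2
  have := hM2 ν
  simp only [clampK]; omega

/-- hence the fold lands INSIDE the box. [folklore] -/
theorem foldB_inside (hlen : ∀ ν, 1 ≤ len ν) (hM2 : ∀ μ, len μ + 2 ≤ M μ) (x : Tor (fine n M)) (ν : Fin d) :
    1 ≤ koff n M lo (foldB n M lo len x) ν ∧ koff n M lo (foldB n M lo len x) ν ≤ len ν := by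
  rw [koffB_foldB n M lo len hlen hM2]
  exact clampN_mem (hlen ν) _

omit [NeZero n] hM in
/-- folded digits are injective in `j`. [folklore] -/
theorem foldDB_injective (k : Fin d → ℕ) : Function.Injective (foldDB n len k) := by
  intro j j' h
  funext μ
  have hμ := congrFun h μ
  simp only [foldDB] at hμ
  split_ifs at hμ with h1
  · exact hμ
  · exact Fin.rev_injective hμ

/-! ## §3 Unit steps in the chart -/

omit [NeZero n] hM in
/-- `cblk k + e_ρ = cblk (k + 1_ρ)`. [folklore] -/
theorem cblkB_add_unitVec (k : Fin d → ℕ) (ρ : Fin d) :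
    cblkB M lo k + unitVec M ρ = cblkB M lo (Function.update k ρ (k ρ + 1)) := by
  funext ν
  simp only [cblkB, Pi.add_apply, unitVec, Function.update_apply]
  by_cases hν : ν = ρ
  · subst hν
    simp only [if_true, Pi.single_eq_same, Nat.cast_succ]
    ring
  · rw [if_neg hν, Pi.single_eq_of_ne hν, add_zero]

omit [NeZero n] hM in
/-- step inside a collar block. [folklore] -/
theorem csiteB_add_unitVec_of_lt (k : Fin d → ℕ) (j : Fin d → Fin n) (ρ : Fin d) (h : (j ρ : ℕ) + 1 < n) :
    csiteB n M lo k j + unitVec (fine n M) ρ = csiteB n M lo k (Function.update j ρ ⟨(j ρ : ℕ) + 1, h⟩) :=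
  bpt_add_unitVec_of_lt n M _ j ρ h

omit hM in
/-- step into the next collar block. [folklore] -/
theorem csiteB_add_unitVec_of_eq (k : Fin d → ℕ) (j : Fin d → Fin n) (ρ : Fin d) (h : (j ρ : ℕ) + 1 = n) :
    csiteB n M lo k j + unitVec (fine n M) ρ = csiteB n M lo (Function.update k ρ (k ρ + 1)) (Function.update j ρ 0) := by
  rw [csiteB, bpt_add_unitVec_of_eq n M _ j ρ h, cblkB_add_unitVec M lo k ρ, csiteB]

/-! ## §4 The fold along a unit step (collar sites `csite k j`, `k ∈ KOff`) -/

omit hM in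
/-- offsets in the index set are below the torus size. [folklore] -/
theorem lt_M_of_mem_KOff (hM2 : ∀ μ, len μ + 2 ≤ M μ) {k : Fin d → ℕ} (hk : k ∈ KOff len) (ν : Fin d) : k ν < M ν :=
  lt_of_lt_of_le ((mem_KOff len).1 hk ν) (hM2 ν)

/-- **INTERIOR STEP, INSIDE DIRECTION**: `F(x + e_ρ) = F x + e_ρ` (the same in-block bond of `K`). [folklore] -/
theorem foldB_step_in (hM2 : ∀ μ, len μ + 2 ≤ M μ) {k : Fin d → ℕ} (hk : k ∈ KOff len) (j : Fin d → Fin n) (ρ : Fin d)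
    (h : (j ρ : ℕ) + 1 < n) (hin : 1 ≤ k ρ ∧ k ρ ≤ len ρ) :
    foldB n M lo len (csiteB n M lo k j + unitVec (fine n M) ρ) = foldB n M lo len (csiteB n M lo k j) + unitVec (fine n M) ρ := by
  have hkM := lt_M_of_mem_KOff M len hM2 hk
  rw [csiteB_add_unitVec_of_lt n M lo k j ρ h, foldB_csiteB n M lo len k hkM, foldB_csiteB n M lo len k hkM]
  have hf : (foldDB n len k j ρ : ℕ) + 1 < n := by simp only [foldDB, if_pos hin]; exact h
  rw [csiteB_add_unitVec_of_lt n M lo _ (foldDB n len k j) ρ hf]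
  congr 1
  funext μ
  simp only [foldDB, Function.update_apply]
  by_cases hμ : μ = ρ
  · subst hμ; simp only [if_true, if_pos hin]
  · simp only [if_neg hμ]

/-- **INTERIOR STEP, OUTSIDE DIRECTION**: `F x = F(x + e_ρ) + e_ρ` (the reversed in-block bond). [folklore] -/
theorem foldB_step_out (hM2 : ∀ μ, len μ + 2 ≤ M μ) {k : Fin d → ℕ} (hk : k ∈ KOff len) (j : Fin d → Fin n) (ρ : Fin d)
    (h : (j ρ : ℕ) + 1 < n) (hout : ¬ (1 ≤ k ρ ∧ k ρ ≤ len ρ)) :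
    foldB n M lo len (csiteB n M lo k j) = foldB n M lo len (csiteB n M lo k j + unitVec (fine n M) ρ) + unitVec (fine n M) ρ := by
  have hkM := lt_M_of_mem_KOff M len hM2 hk
  rw [csiteB_add_unitVec_of_lt n M lo k j ρ h, foldB_csiteB n M lo len k hkM, foldB_csiteB n M lo len k hkM]
  set j' : Fin d → Fin n := Function.update j ρ ⟨(j ρ : ℕ) + 1, h⟩ with hj'
  have hf : (foldDB n len k j' ρ : ℕ) + 1 < n := by
    simp only [foldDB, if_neg hout, hj', Function.update_self, Fin.val_rev]
    omega
  rw [csiteB_add_unitVec_of_lt n M lo _ (foldDB n len k j') ρ hf]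
  congr 1
  funext μ
  simp only [foldDB, Function.update_apply, hj']
  by_cases hμ : μ = ρ
  · subst hμ
    simp only [if_true, if_neg hout]
    apply Fin.ext
    simp only [Fin.val_rev]
    omega
  · simp only [if_neg hμ]

/-- **CROSSING BETWEEN TWO ADJACENT BLOCKS OF THE BOX** (`1 ≤ k_ρ`, `k_ρ + 1 ≤ len_ρ`): `F(x + e_ρ) = F x + e_ρ` — an inter-block
bond of `K`. [folklore] -/
theorem foldB_cross_in (hM2 : ∀ μ, len μ + 2 ≤ M μ) {k : Fin d → ℕ} (hk : k ∈ KOff len) (j : Fin d → Fin n) (ρ : Fin d)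
    (h : (j ρ : ℕ) + 1 = n) (hin : 1 ≤ k ρ ∧ k ρ + 1 ≤ len ρ) :
    foldB n M lo len (csiteB n M lo k j + unitVec (fine n M) ρ) = foldB n M lo len (csiteB n M lo k j) + unitVec (fine n M) ρ := by
  have hkM := lt_M_of_mem_KOff M len hM2 hk
  set k' := Function.update k ρ (k ρ + 1) with hk'
  have hk'mem : k' ∈ KOff len := (mem_KOff len).2 fun ν => by
    rw [hk']; by_cases hν : ν = ρ
    · subst hν; simp only [Function.update_self]; omega
    · rw [Function.update_of_ne hν]; exact (mem_KOff len).1 hk ν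
  have hkM' := lt_M_of_mem_KOff M len hM2 hk'mem
  rw [csiteB_add_unitVec_of_eq n M lo k j ρ h, foldB_csiteB n M lo len k' hkM', foldB_csiteB n M lo len k hkM]
  -- the target blocks are consecutive blocks of `K`, the digits go `n − 1 ↦ 0`
  have hdig : (foldDB n len k j ρ : ℕ) + 1 = n := by
    simp only [foldDB, if_pos (show 1 ≤ k ρ ∧ k ρ ≤ len ρ by omega)]; exact h
  rw [csiteB_add_unitVec_of_eq n M lo _ (foldDB n len k j) ρ hdig]
  congr 1
  · funext ν
    simp only [clampK, hk', Function.update_apply]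
    by_cases hν : ν = ρ
    · subst hν
      simp only [if_true]
      rw [clampN_of_inside (by omega) (by omega), clampN_of_inside hin.1 (by omega)]
    · simp only [if_neg hν]
  · funext μ
    by_cases hμ : μ = ρ
    · subst hμ
      have h1 : 1 ≤ k μ + 1 ∧ k μ + 1 ≤ len μ := by omega
      simp [foldDB, hk', h1]
    · simp only [foldDB, hk', Function.update_apply, if_neg hμ]

/-- **CROSSING INTO THE BOX FROM BELOW** (`k_ρ = 0`): `F(x + e_ρ) = F x`. [folklore] -/
theorem foldB_cross_enter (hM2 : ∀ μ, len μ + 2 ≤ M μ) (hlen : ∀ ν, 1 ≤ len ν) {k : Fin d → ℕ} (hk : k ∈ KOff len)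
    (j : Fin d → Fin n) (ρ : Fin d) (h : (j ρ : ℕ) + 1 = n) (h0 : k ρ = 0) :
    foldB n M lo len (csiteB n M lo k j + unitVec (fine n M) ρ) = foldB n M lo len (csiteB n M lo k j) := by
  have hkM := lt_M_of_mem_KOff M len hM2 hk
  set k' := Function.update k ρ (k ρ + 1) with hk'
  have hk'mem : k' ∈ KOff len := (mem_KOff len).2 fun ν => by
    rw [hk']; by_cases hν : ν = ρ
    · subst hν; simp only [Function.update_self]; have := hlen ν; omega
    · rw [Function.update_of_ne hν]; exact (mem_KOff len).1 hk ν
  have hkM' := lt_M_of_mem_KOff M len hM2 hk'mem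
  rw [csiteB_add_unitVec_of_eq n M lo k j ρ h, foldB_csiteB n M lo len k' hkM', foldB_csiteB n M lo len k hkM]
  congr 1
  · funext ν
    simp only [clampK, hk', Function.update_apply]
    by_cases hν : ν = ρ
    · subst hν; simp only [if_true, h0, zero_add]; unfold clampN; simp [hlen ν]
    · simp only [if_neg hν]
  · funext μ
    simp only [foldDB, hk', Function.update_apply]
    by_cases hμ : μ = ρ
    · subst hμ
      simp only [if_true, h0, zero_add]
      rw [if_pos ⟨le_rfl, hlen μ⟩, if_neg (by omega)]
      apply Fin.ext; simp only [Fin.val_rev, Fin.val_zero]; omega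
    · simp only [if_neg hμ]

/-- **CROSSING OUT OF THE BOX UPWARD** (`k_ρ = len_ρ`): `F(x + e_ρ) = F x`. [folklore] -/
theorem foldB_cross_exit (hM2 : ∀ μ, len μ + 2 ≤ M μ) (hlen : ∀ ν, 1 ≤ len ν) {k : Fin d → ℕ} (hk : k ∈ KOff len)
    (j : Fin d → Fin n) (ρ : Fin d) (h : (j ρ : ℕ) + 1 = n) (hl : k ρ = len ρ) :
    foldB n M lo len (csiteB n M lo k j + unitVec (fine n M) ρ) = foldB n M lo len (csiteB n M lo k j) := by
  have hkM := lt_M_of_mem_KOff M len hM2 hk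
  set k' := Function.update k ρ (k ρ + 1) with hk'
  have hk'mem : k' ∈ KOff len := (mem_KOff len).2 fun ν => by
    rw [hk']; by_cases hν : ν = ρ
    · subst hν; simp only [Function.update_self]; omega
    · rw [Function.update_of_ne hν]; exact (mem_KOff len).1 hk ν
  have hkM' := lt_M_of_mem_KOff M len hM2 hk'mem
  rw [csiteB_add_unitVec_of_eq n M lo k j ρ h, foldB_csiteB n M lo len k' hkM', foldB_csiteB n M lo len k hkM]
  congr 1
  · funext ν
    simp only [clampK, hk', Function.update_apply]
    by_cases hν : ν = ρ
    · subst hν; simp only [if_true, hl]; unfold clampN; have := hlen ν; simp only [show len ν + 1 ≠ 0 by omega, show ¬ (len ν + 1 ≤ len ν) by omega, if_false, show len ν ≠ 0 by omega, le_refl, if_true]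
    · simp only [if_neg hν]
  · funext μ
    simp only [foldDB, hk', Function.update_apply]
    by_cases hμ : μ = ρ
    · subst hμ
      simp only [if_true, hl]
      rw [if_neg (by omega), if_pos ⟨hlen μ, le_rfl⟩]
      apply Fin.ext; simp only [Fin.val_rev, Fin.val_zero]; omega
    · simp only [if_neg hμ]

end Summit.QuantumFields.BalabanUV.T4Continuum.RegionBoxCollarFold

end
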